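import Mathlib
import Literature.NumberTheory.Transcendental.KZProduct
import Literature.NumberTheory.Transcendental.KZCalculusProofs
import Literature.NumberTheory.Transcendental.KZVolumeConjectureProofs
import Literature.NumberTheory.Transcendental.KZCubicalCalculus
import Literature.NumberTheory.Transcendental.SemialgebraicMapsProofs
import Summits.KontsevichZagierPeriods.KontsevichZagierPeriods.Theorems.SoloInformedPolyJacobian
import Summits.KontsevichZagierPeriods.KontsevichZagierPeriods.Theorems.SoloInformedKummerBox
import HarnessLib
import HarnessLib.Audit

/-!
# SoloInformed — the solid under the graph of `1/q` over the unit cube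

For a polynomial `q ∈ ℚ[x₀, …, x_{n−1}]` with `q ≥ 1` on the closed unit cube `[0,1]ⁿ = KZ.cube n`:

* `[[0,1]ⁿ, 1/q]` (`soloInformedRecipRep q hq`) is an integral representation of KZ's literal
  rational shape (`soloInformed_recipRep_isRational`);
* the solid under the graph, `E_q = {(x, t) : x ∈ [0,1]ⁿ, 0 ≤ t, t·q(x) ≤ 1} ⊂ ℝⁿ⁺¹`
  (`soloInformedSubgraphRep q hq`, integrand `1`), is a compact `ℚ`-semialgebraic solid with non-empty
  interior contained in `[0,1]ⁿ⁺¹` — the hypotheses of a volume rung in dimension `n + 1`;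
* ONE Newton–Leibniz move along the last coordinate (primitive `F = t`, limits `0 ≤ t ≤ 1/q(x)`)
  gives `[E_q, 1] ∼ [[0,1]ⁿ, 1/q]` (`soloInformed_subgraphRep_equivalent`), so
  `vol E_q = ∫_{[0,1]ⁿ} dx/q(x)` inside the calculus (`soloInformed_value_subgraphRep`);
* the closed unit cube itself as a volume representation `[[0,1]ᵈ, 1]` (`soloInformedUnitCubeRep d`,
  value `1`).

Instances (`SoloInformedWallFaces`): `q = 1 + x₀⋯x_{n−1}` (volume `(1 − 2^{1−n}) ζ(n)`) and
`q = 1 + x₀²x₁²` (volume Catalan's constant).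

Residency `solo-KontsevichZagierPeriods-informed` (PLAN.md, session s18).
References: M. Kontsevich, D. Zagier, *Periods* (2001), §1.1–§1.2 (rule (3)).
-/

noncomputable section

open MeasureTheory Set Filter
open scoped Topology

namespace Summit.KontsevichZagierPeriods.KontsevichZagierPeriods.Theorems

open Literature.NumberTheory.Transcendental Literature.NumberTheory.Transcendental.KZ
open Literature.ModelTheory.ExponentialFields (IsSemialgebraic isSemialgebraic_setOf_eval_le
  isSemialgebraic_setOf_eval_lt)

variable {n : ℕ}

/-! ### Preliminaries -/

/-- Polynomial functions `x ↦ q(x)` (`q ∈ ℚ[x]`) are continuous on `ℝⁿ`. [folklore] -/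
theorem soloInformed_continuous_aeval (q : MvPolynomial (Fin n) ℚ) :
    Continuous fun x : Fin n → ℝ => (MvPolynomial.aeval x q : ℝ) :=
  continuous_iff_continuousAt.2 fun x => (soloInformed_hasFDerivAt_aeval q x).continuousAt

/-- The open box `(0,1)ⁿ` is open. [folklore] -/
theorem soloInformed_isOpen_box (n : ℕ) : IsOpen {x : Fin n → ℝ | ∀ i, x i ∈ Ioo (0 : ℝ) 1} := by
  have e : {x : Fin n → ℝ | ∀ i, x i ∈ Ioo (0 : ℝ) 1} = ⋂ i, (fun x => x i) ⁻¹' Ioo 0 1 := by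
    ext x
    simp
  rw [e]
  exact isOpen_iInter_of_finite fun i => isOpen_Ioo.preimage (continuous_apply i)

/-- The open box `(0,1)ⁿ` lies in the interior of the closed cube, which is therefore non-empty.
[folklore] -/
theorem soloInformed_interior_cube_nonempty (n : ℕ) : (interior (KZ.cube n)).Nonempty := by
  refine ⟨fun _ => 1 / 2, mem_interior.2 ⟨{x | ∀ i, x i ∈ Ioo (0 : ℝ) 1}, fun x hx i =>
    ⟨(hx i).1.le, (hx i).2.le⟩, soloInformed_isOpen_box n, fun i => ⟨by norm_num, by norm_num⟩⟩⟩

/-! ### The closed unit cube as a volume representation -/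

/-- **`[[0,1]ᵈ, 1]`**, the closed unit cube as a volume representation. -/
def soloInformedUnitCubeRep (d : ℕ) : IntegralRep d where
  domain := KZ.cube d
  integrand _ := 1
  isSemialgebraic_domain := KZ.isSemialgebraic_cube
  isSemialgebraicFunOn_integrand := by simpa using isSemialgebraicFunOn_ratCast KZ.isSemialgebraic_cube 1
  integrableOn := continuous_const.continuousOn.integrableOn_compact KZ.isCompact_cube

/-- Domain of the cube representation. -/
@[simp] theorem soloInformedUnitCubeRep_domain (d : ℕ) : (soloInformedUnitCubeRep d).domain = KZ.cube d := rfl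

/-- The cube representation satisfies the hypotheses of a volume rung. -/
theorem soloInformed_unitCubeRep_isVolume (d : ℕ) :
    IsCompact (soloInformedUnitCubeRep d).domain ∧ (interior (soloInformedUnitCubeRep d).domain).Nonempty ∧
      ∀ x ∈ (soloInformedUnitCubeRep d).domain, (soloInformedUnitCubeRep d).integrand x = 1 :=
  ⟨KZ.isCompact_cube, soloInformed_interior_cube_nonempty d, fun _ _ => rfl⟩

/-- `vol [0,1]ᵈ = 1`. -/
@[simp] theorem soloInformed_value_unitCubeRep (d : ℕ) : (soloInformedUnitCubeRep d).value = 1 := by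
  show ∫ _ in KZ.cube d, (1 : ℝ) = 1
  rw [setIntegral_const, KZ.volume_real_cube, one_smul]

/-! ### `[[0,1]ⁿ, 1/q]` -/

section Recip

variable (q : MvPolynomial (Fin n) ℚ)

/-- `q > 0` on the cube. -/
theorem soloInformed_aeval_pos_of_mem_cube (hq : ∀ x ∈ KZ.cube n, (1 : ℝ) ≤ MvPolynomial.aeval x q)
    {x : Fin n → ℝ} (hx : x ∈ KZ.cube n) :
    0 < (MvPolynomial.aeval x q : ℝ) :=
  lt_of_lt_of_le one_pos (hq x hx)

/-- **`[[0,1]ⁿ, 1/q]`**: the reciprocal of a polynomial `q ≥ 1` over the closed unit cube. -/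
def soloInformedRecipRep (hq : ∀ x ∈ KZ.cube n, (1 : ℝ) ≤ MvPolynomial.aeval x q) : IntegralRep n where
  domain := KZ.cube n
  integrand x := (MvPolynomial.aeval x q : ℝ)⁻¹
  isSemialgebraic_domain := KZ.isSemialgebraic_cube
  isSemialgebraicFunOn_integrand :=
    (isSemialgebraicFunOn_aeval KZ.isSemialgebraic_cube q).inv fun _ hx =>
      (soloInformed_aeval_pos_of_mem_cube q hq hx).ne'
  integrableOn :=
    ((soloInformed_continuous_aeval q).continuousOn.inv₀ fun _ hx =>
      (soloInformed_aeval_pos_of_mem_cube q hq hx).ne').integrableOn_compact KZ.isCompact_cube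

/-- Domain of `[[0,1]ⁿ, 1/q]`. -/
@[simp] theorem soloInformedRecipRep_domain (hq : ∀ x ∈ KZ.cube n, (1 : ℝ) ≤ MvPolynomial.aeval x q) :
    (soloInformedRecipRep q hq).domain = KZ.cube n := rfl

/-- Integrand of `[[0,1]ⁿ, 1/q]`. -/
@[simp] theorem soloInformedRecipRep_integrand (hq : ∀ x ∈ KZ.cube n, (1 : ℝ) ≤ MvPolynomial.aeval x q) :
    (soloInformedRecipRep q hq).integrand = fun x => (MvPolynomial.aeval x q : ℝ)⁻¹ := rfl

/-- `[[0,1]ⁿ, 1/q]` has KZ's literal rational shape. -/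
theorem soloInformed_recipRep_isRational (hq : ∀ x ∈ KZ.cube n, (1 : ℝ) ≤ MvPolynomial.aeval x q) :
    (soloInformedRecipRep q hq).IsRational :=
  ⟨1, q, fun _ hx => (soloInformed_aeval_pos_of_mem_cube q hq hx).ne', fun x _ => by simp⟩

/-- `value [[0,1]ⁿ, 1/q] = ∫_{[0,1]ⁿ} dx/q(x)`. -/
theorem soloInformed_value_recipRep (hq : ∀ x ∈ KZ.cube n, (1 : ℝ) ≤ MvPolynomial.aeval x q) :
    (soloInformedRecipRep q hq).value = ∫ x in KZ.cube n, (MvPolynomial.aeval x q : ℝ)⁻¹ := rfl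

/-! ### The solid `E_q` under the graph of `1/q` -/

/-- `E_q = {(x, t) ∈ ℝⁿ⁺¹ : x ∈ [0,1]ⁿ, 0 ≤ t, t · q(x) ≤ 1}`. -/
def soloInformedSubgraphDom : Set (Fin (n + 1) → ℝ) :=
  {z | (Fin.init z : Fin n → ℝ) ∈ KZ.cube n ∧ 0 ≤ z (Fin.last n) ∧
    z (Fin.last n) * MvPolynomial.aeval (Fin.init z) q ≤ 1}

/-- `E_q` is `ℚ`-semialgebraic (no Tarski–Seidenberg: polynomial inequalities). -/
theorem isSemialgebraic_soloInformedSubgraphDom : IsSemialgebraic ℚ (soloInformedSubgraphDom q) := by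
  have h1 : IsSemialgebraic ℚ {z : Fin (n + 1) → ℝ | (Fin.init z : Fin n → ℝ) ∈ KZ.cube n} :=
    KZ.isSemialgebraic_cube.setOf_init_mem
  have h2 := isSemialgebraic_setOf_eval_le (k := ℚ) (R := ℝ) (0 : MvPolynomial (Fin (n + 1)) ℚ)
    (MvPolynomial.X (Fin.last n))
  have h3 := isSemialgebraic_setOf_eval_le (k := ℚ) (R := ℝ)
    (MvPolynomial.X (Fin.last n) * MvPolynomial.rename Fin.castSucc q)
    (1 : MvPolynomial (Fin (n + 1)) ℚ)
  simp only [map_zero, map_one, map_mul, MvPolynomial.aeval_X, MvPolynomial.aeval_rename] at h2 h3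
  convert (h1.inter h2).inter h3 using 1
  ext z
  simp only [soloInformedSubgraphDom, mem_setOf_eq, mem_inter_iff]
  exact ⟨fun ⟨a, b, c⟩ => ⟨⟨a, b⟩, c⟩, fun ⟨⟨a, b⟩, c⟩ => ⟨a, b, c⟩⟩

/-- `E_q ⊆ [0,1]ⁿ⁺¹` (since `q ≥ 1`). -/
theorem soloInformedSubgraphDom_subset_cube (hq : ∀ x ∈ KZ.cube n, (1 : ℝ) ≤ MvPolynomial.aeval x q) :
    soloInformedSubgraphDom q ⊆ KZ.cube (n + 1) := by
  rintro z ⟨h0, h1, h2⟩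
  rw [KZ.cube_succ_eq]
  refine ⟨h0, h1, ?_⟩
  have hq1 := hq _ h0
  nlinarith

/-- `E_q` is compact. -/
theorem isCompact_soloInformedSubgraphDom (hq : ∀ x ∈ KZ.cube n, (1 : ℝ) ≤ MvPolynomial.aeval x q) :
    IsCompact (soloInformedSubgraphDom q) := by
  refine KZ.isCompact_cube.of_isClosed_subset ?_ (soloInformedSubgraphDom_subset_cube q hq)
  have h : IsClosed ((Fin.init ⁻¹' KZ.cube n : Set (Fin (n + 1) → ℝ)) ∩
      ({z | 0 ≤ z (Fin.last n)} ∩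
        {z | z (Fin.last n) * MvPolynomial.aeval (Fin.init z) q ≤ 1})) :=
    (KZ.isClosed_cube.preimage SoloInformed.continuous_init).inter
      ((isClosed_le continuous_const (continuous_apply _)).inter
        (isClosed_le ((continuous_apply _).mul
          ((soloInformed_continuous_aeval q).comp SoloInformed.continuous_init)) continuous_const))
  convert h using 1
  ext z
  simp only [soloInformedSubgraphDom, mem_setOf_eq, mem_inter_iff, mem_preimage]

/-- `E_q` has non-empty interior: it contains the open set
`{x ∈ (0,1)ⁿ, 0 < t, t·q(x) < 1}`, which contains `(½, …, ½, 1/(2 q(½, …, ½)))`. -/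
theorem soloInformed_interior_subgraphDom_nonempty (hq : ∀ x ∈ KZ.cube n, (1 : ℝ) ≤ MvPolynomial.aeval x q) :
    (interior (soloInformedSubgraphDom q)).Nonempty := by
  set c : Fin n → ℝ := fun _ => 1 / 2 with hc
  have hcm : c ∈ KZ.cube n := fun i => ⟨by norm_num [hc], by norm_num [hc]⟩
  have hM : 0 < (MvPolynomial.aeval c q : ℝ) := soloInformed_aeval_pos_of_mem_cube q hq hcm
  refine ⟨Fin.snoc c (1 / (2 * MvPolynomial.aeval c q)), mem_interior.2
    ⟨{z | (∀ i, (Fin.init z : Fin n → ℝ) i ∈ Ioo (0 : ℝ) 1) ∧ 0 < z (Fin.last n) ∧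
      z (Fin.last n) * MvPolynomial.aeval (Fin.init z) q < 1}, ?_, ?_, ?_⟩⟩
  · rintro z ⟨hz0, hz1, hz2⟩
    exact ⟨fun i => ⟨(hz0 i).1.le, (hz0 i).2.le⟩, hz1.le, hz2.le⟩
  · have hU : IsOpen ((Fin.init ⁻¹' {x : Fin n → ℝ | ∀ i, x i ∈ Ioo (0 : ℝ) 1} :
        Set (Fin (n + 1) → ℝ)) ∩ ({z | 0 < z (Fin.last n)} ∩
          {z | z (Fin.last n) * MvPolynomial.aeval (Fin.init z) q < 1})) :=
      ((soloInformed_isOpen_box n).preimage SoloInformed.continuous_init).inter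
        ((isOpen_lt continuous_const (continuous_apply _)).inter
          (isOpen_lt ((continuous_apply _).mul
            ((soloInformed_continuous_aeval q).comp SoloInformed.continuous_init)) continuous_const))
    convert hU using 1
    ext z
    simp only [mem_setOf_eq, mem_inter_iff, mem_preimage]
  · refine ⟨fun i => ?_, ?_, ?_⟩
    · simp only [Fin.init_snoc]
      constructor <;> norm_num [hc]
    · simp only [Fin.snoc_last]
      positivity
    · simp only [Fin.init_snoc, Fin.snoc_last]
      rw [one_div_mul_eq_div, div_lt_one (by positivity)]
      linarith

/-- **The solid `[E_q, 1]`** under the graph of `1/q` over the unit cube. -/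
def soloInformedSubgraphRep (hq : ∀ x ∈ KZ.cube n, (1 : ℝ) ≤ MvPolynomial.aeval x q) : IntegralRep (n + 1) where
  domain := soloInformedSubgraphDom q
  integrand _ := 1
  isSemialgebraic_domain := isSemialgebraic_soloInformedSubgraphDom q
  isSemialgebraicFunOn_integrand := by
    simpa using isSemialgebraicFunOn_ratCast (isSemialgebraic_soloInformedSubgraphDom q) 1
  integrableOn :=
    continuous_const.continuousOn.integrableOn_compact (isCompact_soloInformedSubgraphDom q hq)

/-- Domain of `[E_q, 1]`. -/
@[simp] theorem soloInformedSubgraphRep_domain (hq : ∀ x ∈ KZ.cube n, (1 : ℝ) ≤ MvPolynomial.aeval x q) :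
    (soloInformedSubgraphRep q hq).domain = soloInformedSubgraphDom q := rfl

/-- Integrand of `[E_q, 1]`. -/
@[simp] theorem soloInformedSubgraphRep_integrand (hq : ∀ x ∈ KZ.cube n, (1 : ℝ) ≤ MvPolynomial.aeval x q) :
    (soloInformedSubgraphRep q hq).integrand = fun _ => 1 := rfl

/-- `[E_q, 1]` satisfies the hypotheses of the volume rung `n + 1`: compact domain, non-empty
interior, integrand `1`. -/
theorem soloInformed_subgraphRep_isVolume (hq : ∀ x ∈ KZ.cube n, (1 : ℝ) ≤ MvPolynomial.aeval x q) :
    IsCompact (soloInformedSubgraphRep q hq).domain ∧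
      (interior (soloInformedSubgraphRep q hq).domain).Nonempty ∧
      ∀ x ∈ (soloInformedSubgraphRep q hq).domain, (soloInformedSubgraphRep q hq).integrand x = 1 :=
  ⟨isCompact_soloInformedSubgraphDom q hq, soloInformed_interior_subgraphDom_nonempty q hq,
    fun _ _ => rfl⟩

/-- **One Newton–Leibniz move: `[E_q, 1] ∼ [[0,1]ⁿ, 1/q]`** (primitive `F = t` along the last
coordinate, limits `0 ≤ t ≤ 1/q(x)`). [Kontsevich–Zagier 2001, §1.2 rule (3)] -/
theorem soloInformed_subgraphRep_equivalent (hq : ∀ x ∈ KZ.cube n, (1 : ℝ) ≤ MvPolynomial.aeval x q) :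
    Equivalent (soloInformedSubgraphRep q hq) (soloInformedRecipRep q hq) := by
  refine newtonLeibnizRel_subset_relations ⟨n, soloInformedSubgraphRep q hq, soloInformedRecipRep q hq,
    fun _ => ((0 : ℕ) : ℝ), fun y => (MvPolynomial.aeval y q : ℝ)⁻¹, fun z => z (Fin.last n),
    soloInformed_isSemialgebraicFunOn_apply (isSemialgebraic_soloInformedSubgraphDom q) _,
    isSemialgebraicFunOn_natCast KZ.isSemialgebraic_cube 0,
    (soloInformedRecipRep q hq).isSemialgebraicFunOn_integrand, ?_, ?_, ?_, ?_, ?_, rfl⟩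
  · intro x hx
    simp only [Nat.cast_zero]
    exact inv_nonneg.2 (soloInformed_aeval_pos_of_mem_cube q hq hx).le
  · ext z
    show ((Fin.init z : Fin n → ℝ) ∈ KZ.cube n ∧ 0 ≤ z (Fin.last n) ∧
        z (Fin.last n) * MvPolynomial.aeval (Fin.init z) q ≤ 1) ↔
      ((Fin.init z : Fin n → ℝ) ∈ KZ.cube n ∧ ((0 : ℕ) : ℝ) ≤ z (Fin.last n) ∧
        z (Fin.last n) ≤ (MvPolynomial.aeval (Fin.init z) q : ℝ)⁻¹)
    simp only [Nat.cast_zero]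
    constructor
    · rintro ⟨h0, h1, h2⟩
      have hp := soloInformed_aeval_pos_of_mem_cube q hq h0
      refine ⟨h0, h1, ?_⟩
      rw [inv_eq_one_div, le_div_iff₀ hp]
      exact h2
    · rintro ⟨h0, h1, h2⟩
      have hp := soloInformed_aeval_pos_of_mem_cube q hq h0
      rw [inv_eq_one_div, le_div_iff₀ hp] at h2
      exact ⟨h0, h1, h2⟩
  · intro x _
    simp only [Fin.snoc_last]
    exact continuousOn_id
  · intro x _ t _
    show HasDerivAt (fun s : ℝ => (Fin.snoc x s : Fin (n + 1) → ℝ) (Fin.last n)) 1 t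
    simp only [Fin.snoc_last]
    exact hasDerivAt_id' t
  · intro x _
    simp [Fin.snoc_last]

/-- **`vol E_q = ∫_{[0,1]ⁿ} dx/q(x)`**, computed inside the calculus (the value is a move invariant). -/
theorem soloInformed_value_subgraphRep (hq : ∀ x ∈ KZ.cube n, (1 : ℝ) ≤ MvPolynomial.aeval x q) :
    (soloInformedSubgraphRep q hq).value = ∫ x in KZ.cube n, (MvPolynomial.aeval x q : ℝ)⁻¹ := by
  rw [Equivalent.value_eq_holds (soloInformed_subgraphRep_equivalent q hq)]
  rfl

end Recip

end Summit.KontsevichZagierPeriods.KontsevichZagierPeriods.Theorems
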